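import Mathlib.Analysis.InnerProductSpace.PiL2
import Mathlib.Analysis.Complex.Basic
import Mathlib.Topology.UniformSpace.UniformConvergence
import Mathlib.Topology.UniformSpace.CompactConvergence
import Mathlib.Topology.UniformSpace.HeineCantor
import Mathlib.Topology.MetricSpace.ProperSpace
import Mathlib.Topology.MetricSpace.Thickening
import Mathlib.Topology.Homeomorph.Lemmas
import Mathlib.Topology.Separation.Regular

/-!
# Localising uniform convergence through an injection into `ℝᴺ`

Crux `WitnessCharge` (item stmt-SmoothPoincare4-7824, route route-SmoothPoincare4-SullivanDual),
line `Sketch`, stub `helper_uniformLimit_localise`.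

In the frontier dichotomy (P5) of Gromov's pencil, limits of `J`-curves in the compact manifold
`X = Σ` are extracted after a Whitney embedding `ι : X → ℝᴺ` (continuous and injective on the
compact Hausdorff space `X`): the maps `ι ∘ h j` converge uniformly on a compact `D ⊆ ℂ` to
`ι ∘ hlim`. This file localises that convergence: (1) if `hlim '' D` lies in an open `O ⊆ X`, then
so does `h j '' D` for all large `j`; (2) composing with any `F : X → ℝ⁴` continuous on `O`
(a chart) preserves the uniform convergence on `D`.

Proof. (1) `K := hlim '' D` is compact and `ι '' K` is disjoint from the compact, hence closed,
set `ι '' Oᶜ`; some `δ`-thickening of `ι '' K` still misses it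
(`IsCompact.exists_thickening_subset_open`), and uniform convergence at scale `δ` puts `ι (h j z)`
(`z ∈ D`) in that thickening for large `j`, whence `h j z ∈ O` by injectivity of `ι`.
(2) Choose an open `O'` with `K ⊆ O'` and `closure O' ⊆ O` (`exists_open_between_and_isCompact_closure`,
`X` being compact Hausdorff). Since `ι` is a closed embedding (`Continuous.isClosedEmbedding`),
`F ∘ ι⁻¹` is continuous on the compact set `ι '' closure O'`
(`Topology.IsInducing.continuousOn_image_iff`), hence uniformly continuous there (Heine–Cantor,
`IsCompact.uniformContinuousOn_of_continuous`); combining this with (1) for `O'` and with the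
uniform convergence of `ι ∘ h j` gives the claim through `Metric.tendstoUniformlyOn_iff`.
-/

noncomputable section

set_option linter.dupNamespace false

open Set Filter Topology Metric

namespace Summit.SmoothPoincare4.SmoothPoincare4.Theorems.WitnessCharge.PencilIncompleteness

/-- **Localising uniform convergence through an injection into `ℝᴺ`.** Let `X` be a compact
Hausdorff space, `ι : X → ℝᴺ` continuous and injective, `D ⊆ ℂ` compact, `hlim` continuous on
`D`, and suppose `ι ∘ h j → ι ∘ hlim` uniformly on `D` as `j → ∞`. If `hlim` maps `D` into an
open set `O ⊆ X`, then (1) `h j` maps `D` into `O` for all large `j`, and (2) for every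
`F : X → ℝ⁴` continuous on `O`, `F ∘ h j → F ∘ hlim` uniformly on `D`. (1): a thickening of the
compact set `ι '' (hlim '' D)` misses the closed set `ι '' Oᶜ`. (2): `F ∘ ι⁻¹` is uniformly
continuous on the compact set `ι '' closure O'` for an open `O' ⊇ hlim '' D` with
`closure O' ⊆ O`, because `ι` is a closed embedding; combine with (1) applied to `O'`. -/
theorem helper_uniformLimit_localise :
    ∀ (X : Type) [TopologicalSpace X] [CompactSpace X] [T2Space X] (N : ℕ)
      (ι : X → EuclideanSpace ℝ (Fin N)), Continuous ι → Function.Injective ι →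
      ∀ (h : ℕ → ℂ → X) (hlim : ℂ → X) (D : Set ℂ), IsCompact D →
        TendstoUniformlyOn (fun j z => ι (h j z)) (fun z => ι (hlim z)) atTop D →
        ContinuousOn hlim D →
        ∀ (O : Set X), IsOpen O → MapsTo hlim D O →
          (∀ᶠ j in atTop, MapsTo (h j) D O) ∧
          ∀ (F : X → EuclideanSpace ℝ (Fin 4)), ContinuousOn F O →
            TendstoUniformlyOn (fun j z => F (h j z)) (fun z => F (hlim z)) atTop D := by
  intro X _ _ _ N ι hιc hιi h hlim D hD hunif hcont O hO hmaps
  -- the compact set `K := hlim '' D ⊆ O`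
  have hK : IsCompact (hlim '' D) := hD.image_of_continuousOn hcont
  have hKO : hlim '' D ⊆ O := hmaps.image_subset
  -- (1), for an arbitrary open set `U ⊇ K`
  have step1 : ∀ U : Set X, IsOpen U → hlim '' D ⊆ U → ∀ᶠ j in atTop, MapsTo (h j) D U := by
    intro U hU hKU
    have hUc : IsCompact (ι '' Uᶜ) := hU.isClosed_compl.isCompact.image hιc
    have hsub : ι '' (hlim '' D) ⊆ (ι '' Uᶜ)ᶜ := by
      rintro _ ⟨x, hx, rfl⟩ ⟨y, hy, hxy⟩
      obtain rfl := hιi hxy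
      exact hy (hKU hx)
    obtain ⟨δ, hδ, hthick⟩ :=
      (hK.image hιc).exists_thickening_subset_open hUc.isClosed.isOpen_compl hsub
    filter_upwards [Metric.tendstoUniformlyOn_iff.mp hunif δ hδ] with j hj z hz
    by_contra hzU
    have hmem : ι (h j z) ∈ thickening δ (ι '' (hlim '' D)) :=
      Metric.mem_thickening_iff.mpr
        ⟨ι (hlim z), mem_image_of_mem ι (mem_image_of_mem hlim hz),
          by rw [dist_comm]; exact hj z hz⟩
    exact hthick hmem ⟨h j z, hzU, rfl⟩
  refine ⟨step1 O hO hKO, fun F hF => ?_⟩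
  -- (2): shrink `O` to an open `O' ⊇ K` with compact closure inside `O`
  obtain ⟨O', hO', hKO', hclO', hCc⟩ := exists_open_between_and_isCompact_closure hK hO hKO
  haveI : Nonempty X := ⟨hlim 0⟩
  -- `F ∘ ι⁻¹` is continuous, hence uniformly continuous, on the compact set `ι '' closure O'`
  have hGcont : ContinuousOn (F ∘ Function.invFun ι) (ι '' closure O') := by
    rw [(hιc.isClosedEmbedding hιi).isInducing.continuousOn_image_iff, Function.comp_assoc,
      Function.invFun_comp hιi, Function.comp_id]
    exact hF.mono hclO'
  have hGι : ∀ x, (F ∘ Function.invFun ι) (ι x) = F x := fun x =>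
    congrArg F (Function.leftInverse_invFun hιi x)
  have hGunif := Metric.uniformContinuousOn_iff.mp
    ((hCc.image hιc).uniformContinuousOn_of_continuous hGcont)
  rw [Metric.tendstoUniformlyOn_iff]
  intro ε hε
  obtain ⟨δ, hδ, hδε⟩ := hGunif ε hε
  filter_upwards [step1 O' hO' hKO', Metric.tendstoUniformlyOn_iff.mp hunif δ hδ] with j hjO' hjδ
    z hz
  have h1 : ι (hlim z) ∈ ι '' closure O' :=
    mem_image_of_mem ι (subset_closure (hKO' (mem_image_of_mem hlim hz)))
  have h2 : ι (h j z) ∈ ι '' closure O' := mem_image_of_mem ι (subset_closure (hjO' hz))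
  have key := hδε (ι (hlim z)) h1 (ι (h j z)) h2 (hjδ z hz)
  rwa [hGι, hGι] at key

end Summit.SmoothPoincare4.SmoothPoincare4.Theorems.WitnessCharge.PencilIncompleteness
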